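import Mathlib
import HarnessLib

/-!
# Markman 2025 — PROPOSITION 6.1.2 («`ρ′_g = exp(½[c₁(𝒫) − ρ_g(c₁(𝒫))]) ∪ ρ_g`»): the DIMENSION COUNTS of its proof,
# Steps 2–3 (reduction of the `Spin(V)`-equivariance of Orlov's equivalence to the surface case via [Ob, Theorem B]),
# the induction of Step 4, and the integrality remark — AS PRINTED (v2 p. 32 L8 – p. 33 L29), kernel-checked

E. Markman: [M] *Cycles on abelian 2n-folds of Weil type from secant sheaves on abelian n-folds*,
arXiv:2502.03415 **v2** (2025-06-08), bib `Markman2025SecantWeil` — UNREFEREED PREPRINT. «p. N L m» = PyMuPDF line `m`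
of page `N` of the public v2 PDF (sha256/16 `8155aa33870069b8`), read at seat lit-w-markman g22 (pub-hsemireg LIT-W,
2026-08-25; §6.1 p. 30 L40 – p. 33 L29 from the numbered text layer, p. 32 L8–53 and p. 33 L3–29 re-read BY EYE on the
renders `r_mar25v2_p32_prop612.png`, `r_mar25v2_p33_steps.png` in `HOME/lit/Markman-renders-litw-markman-g22/`; sheet
`LOCATOR-SHEET-MARKMAN.md` §68). Proposition 6.1.2 is the `Spin(V)`-equivariance property of Orlov's equivalence
`Φ : D^b(X × X) → D^b(X × X̂)` ((6.1.2)); it is the input «BY VALUE» of `KappaClassInvariance.lean` (Cor. 1.3.2: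
`ρ′_g(ch(E)) = ch(E)` ⇒ `κ(E)` is `ρ_g`-invariant) and, through it, of the rows M-Mk1 ∕ M-Mk9 of the LIT-W table that the
W1 «derived autoequivalence orbits» seats score against. [Ob] = A. L. Onishchik's theorem on subgroups of maximal
dimension (reference [Ob] of [M]); it enters BY VALUE.

## What is printed (verbatim; displays linearised)

* (6.1.4)–(6.1.7), p. 31 L23–44: «Given `g ∈ Spin(V)`, the composition (6.1.4) `ρ′_g := ϕ(m_g × m†_g)ϕ⁻¹ : ∧•V → ∧•V`
  does not preserve the grading, but it preserves the decreasing filtration by the subspaces (6.1.5)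
  `F^k(∧•V) := ⊕_{i≥k} ∧^i V`, and the induced graded action is the one induced from `ρ : Spin(V) → SO(V)` … We thus
  get two `Spin(V)` actions on `∧^*V` (6.1.6) `ρ : Spin(V) → GL(∧^*V)`, (6.1.7) `ρ′ : Spin(V) → GL(∧^*V)`».
* PROPOSITION 6.1.2 (p. 32 L8–19): «The following equality holds (6.1.10) `ρ′_g = exp(½[c₁(𝒫) − ρ_g(c₁(𝒫))]) ∪ ρ_g`.
  Notice that the integral alternating bilinear form `c₁(𝒫)` and the symmetric bilinear pairing `(•, •)_V` agree
  modulo 2, and so the class `½[c₁(𝒫) − ρ_g(c₁(𝒫))]` is indeed integral, for every element `g ∈ Spin(V)`.»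
* PROOF, Step 1 (p. 32 L22–32): «The special case of the statement, when `X` is an abelian surface, is proved in Lemma
  6.2.5 below. We prove that the general case follows from the surface case. Step 1: If `X₁` and `X₂` are abelian
  varieties and `X = X₁ × X₂` and the conjecture is known for `X`, then it follows for `X_i`, since it holds for the
  image of `Spin(V_{X₁}) × Spin(V_{X₂})` in `Spin(V_X)` via the identification of `V_X` with `V_{X₁} ⊕ V_{X₂}`. … It
  suffices to prove the conjecture for one abelian variety in each dimension, hence for powers `Eⁿ` of an elliptic
  curve `E`, as it is topological in nature. The statement for abelian varieties of dimension `n` thus implies the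
  statement for abelian varieties of lower dimension.»
* Step 2 (p. 32 L33–53, p. 33 L3–14): «The case `n = 2` is assumed. We prove next that if the statement holds for
  abelian varieties of dimension `2k`, `k ≥ 1`, then it holds for abelian varieties of dimension `3k`. Write
  `V = V_{E^{3k}}`. Then `V = V₁ ⊕ V₂ ⊕ V₃`, where `V_i = V_{E^k}`, for `1 ≤ i ≤ 3`. Both representations `ρ` and `ρ′` of
  `Spin(V)` factor through `SO₊(V)`. Set `G₁ := SO₊(V₁) × SO₊(V₂ ⊕ V₃)`, `G₂ := SO₊(V₂) × SO₊(V₁ ⊕ V₃)`,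
  `G₃ := SO₊(V₃) × SO₊(V₁ ⊕ V₂)`. Let `f : G₁ × G₂ × G₃ → SO₊(V)` send `(g₁, g₂, g₃)` to `g₁g₂g₃`. The subset of
  `SO₊(V)`, consisting of elements `g` for which equality (6.1.10) holds, is a subgroup. Hence, it suffices to show
  that the Zariski closure in `SO₊(V_ℚ)` of the subgroup generated by the image of `f` is the whole of `SO₊(V_ℚ)`. The
  dimension of `SO₊(V_ℚ)` is `72k² − 6k` and any closed subgroup of `SO₊(V_ℚ)` of dimension larger than
  `(12k − 1)(12k − 2)/2` is equal to `SO₊(V_ℚ)`, by [Ob, Theorem B]. Hence, it suffices to prove that the dimension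
  of the Zariski closure of the image of `f` is `dim(SO₊(V_ℚ)) − 2`. … We conclude that the fiber of
  `f : G₁ × G₂ × G₃ → SO₊(V_ℚ)` over `1` has dimension `2[3 dim SO₊(V_{i,ℚ}) + 1] = 12k(4k − 1) + 2`. Now
  `dim(G_i) = 2k[20k − 3]`. Hence, the dimension of the image of `f` is
  `6k[20k − 3] − [12k(4k − 1) + 2] = 72k² − 6k − 2 = dim SO₊(V_ℚ) − 2`.»
* Step 3 (p. 33 L15–21): «We prove next the case `n = 4`. We decompose `V_{E⁴}` as the direct sum `V₁ ⊕ V₂ ⊕ V₃`,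
  where `V₁ = V₂ = V_{E¹}` and `V₃ = V_{E²}`. We set `G_i`, `1 ≤ i ≤ 3`, and `f : G₁ × G₂ × G₃ → SO₊(V)` as in Step 2.
  Then `dim(G₁ × G₂ × G₃) = 200`, `dim SO₊(V_ℚ) = 120`, and the same argument as in Step 2 shows that the fiber
  `f⁻¹(1)` consists of triples `(g₁, g₂, g₃)`, such that each `g_i` maps each `V_j` to itself. Hence, the dimension
  of the fiber `f⁻¹(1)` is `82`. Again we get that the closure of the image of `f` has codimension `2`.»
* Step 4 (p. 33 L22–28): «We complete the proof by induction on `n`. The case `n = 2` is assumed and implies the case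
  `n = 1`, by Step 1. The case `n = 3` follows from Step 2 and the case `n = 4` from Step 3. Assume that `n ≥ 4` and
  the statement holds for `E^k`, for `k ≤ n`. We prove it for `E^{n+1}`. If `n` is even, then the statement holds for
  `E^{3n/2}`, by Step 2 and the induction hypothesis, and so for `n + 1`, by Step 1, since `n + 1 < 3n/2`. If `n` is
  odd, then `n ≥ 5`, the statement holds for `E^{3(n−1)/2}` by Step 2 and the induction hypothesis, and so for
  `n + 1`, by Step 1, since `n + 1 ≤ 3(n − 1)/2`.»
* (1.2.1), p. 3 L49–52: «`V := H¹(X, ℤ) ⊕ H¹(X̂, ℤ)`» (rank `4n` for an abelian `n`-fold, `rank H¹(X, ℤ) = 2n`).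

## What this file proves (0 `def`, 0 named fact, 0 sorry; the finite arithmetic and the induction scheme ONLY)

Throughout, the dimension of `SO₊` of a rank-`m` quadratic space is written `m.choose 2 = m(m − 1)/2` and
`rank V_{E^k} = 4k` (so `rank V_{E^{3k}} = 12k`, `rank(V_i ⊕ V_j) = 8k`; in Step 3 the ranks are `4, 4, 8`, total `16`).
§A (Step 2): `dimSO_12k` («The dimension of `SO₊(V_ℚ)` is `72k² − 6k`»), `threshold_12k` ([Ob]'s bound
`(12k − 1)(12k − 2)/2 = 72k² − 18k + 1`), `dimG` («`dim(G_i) = 2k[20k − 3]`» `= dim SO(4k) + dim SO(8k)`), `fiber_dim`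
(«`2[3 dim SO₊(V_{i,ℚ}) + 1] = 12k(4k − 1) + 2`», the printed formula evaluated — its derivation from the fibre
description is [M]'s and is NOT modelled), `image_dim` («`6k[20k − 3] − [12k(4k − 1) + 2] = 72k² − 6k − 2`»),
`image_dim_eq_dimSO_sub_two` («`= dim SO₊(V_ℚ) − 2`»), `image_dim_gt_threshold` (codimension `2` beats [Ob]'s bound
iff `12k > 3`, true for `k ≥ 1` — the tacit comparison behind «Hence, it suffices …»); PRINT-READING PRECISION P-6.1.2
(seat remark ×1, NOT an erratum claim): the block-diagonal count of the fibre has no «`+ 1`» and would make the image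
of `f` full-dimensional (`image_dim_blockCount`, `image_dim_blockCount_step3`) — Step 2's conclusion holds under
either count, since only «image dimension > [Ob]'s threshold» is used.
§B (Step 3, `n = 4`): `dimG_step3` (`72 + 72 + 56 = 200`), `dimSO_16` (`120`), `fiber_dim_step3` (the same printed
formula `2[dim SO(4) + dim SO(4) + dim SO(8) + 1] = 82`), `image_codim_step3` (`200 − 82 = 120 − 2`),
`threshold_16` (`(15·14)/2 = 105 < 118`).
§C (Steps 1 and 4, the induction scheme): for a predicate `P` on dimensions with `P 2` (surface case, Lemma 6.2.5 BY
VALUE), Step 1 (`P n → m ≤ n → P m`), Step 2 (`P (2k) → P (3k)` for `k ≥ 1`) and Step 3 (`P 3 → P 4`, the printed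
«case `n = 4` from Step 3» read with its Step-2-type input `SO₊(V_{E¹}) × SO₊(V_{E³})`), one gets `P n` for every
`n ≥ 1` (`all_of_steps`), via exactly the printed moves: `step4_even` (`n` even, `n ≥ 4`: `n + 1 < 3n/2` and
`3n/2 = 3·(n/2)`, `n = 2·(n/2)`), `step4_odd` (`n` odd, `n ≥ 5`: `n + 1 ≤ 3(n − 1)/2`).
§D (the integrality remark): if an integer-valued form `c` agrees with a form `B` modulo `2` at every pair and `ρ`
preserves `B`, then `c(x, y) − c(ρx, ρy)` is even at every pair (`even_sub_of_agree_mod_two`) — the value-level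
content of «`½[c₁(𝒫) − ρ_g(c₁(𝒫))]` is indeed integral» (`ρ_g(c₁(𝒫))(x, y) = c₁(𝒫)(ρ_g⁻¹x, ρ_g⁻¹y)`; that an
alternating form with even values is twice an integral alternating form is the standard basis argument, not repeated).
BY VALUE ∕ NOT modelled: `Spin(V)`, `SO₊`, Orlov's `Φ`, (6.1.8)–(6.1.9), [Ob, Theorem B] itself, the subgroup and
Zariski-closure sentences, the fibre description «each `g_i` maps each `V_j` to itself» (p. 33 L3–11) and WHY its
dimension is the printed `2[3 dim SO₊(V_i) + 1]`, Lemma 6.2.5 (the surface case), Step 1's product argument. This file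
re-proves no statement of [M]; it certifies that the printed numbers are mutually consistent and that the printed
induction closes. Nothing here says that any object of the pub-hsemireg cell is semiregular, or that HC ∕ HC_CM ∕
HC_AV is proved.
-/

namespace Literature.AlgebraicGeometry.Markman2025.Prop612

/-! ### §A — Step 2: `V = V_{E^{3k}} = V₁ ⊕ V₂ ⊕ V₃`, `rank V_i = 4k`, `rank V = 12k` -/

/-- `dim SO(m) = m(m − 1)/2 = C(m, 2)`, the closed form used for every count below (Mathlib).
[cite: Markman2025SecantWeil, proof of Prop. 6.1.2 Step 2, p. 32 L50] -/
theorem dimSO_eq (m : ℕ) : m.choose 2 = m * (m - 1) / 2 := Nat.choose_two_right m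

/-- «The dimension of `SO₊(V_ℚ)` is `72k² − 6k`» (`rank V_ℚ = 12k`): `C(12k, 2) = 6k(12k − 1)`, i.e.
`C(12k, 2) + 6k = 72k²`. [cite: Markman2025SecantWeil, proof of Prop. 6.1.2 Step 2, p. 32 L50] -/
theorem dimSO_12k (k : ℕ) : (12 * k).choose 2 = 6 * k * (12 * k - 1) := by
  rw [Nat.choose_two_right]
  exact Nat.div_eq_of_eq_mul_left (by norm_num) (by ring)

/-- The printed form «`72k² − 6k`» of `dim SO₊(V_ℚ)` (subtraction-free: `dim + 6k = 72k²`).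
[cite: Markman2025SecantWeil, proof of Prop. 6.1.2 Step 2, p. 32 L50] -/
theorem dimSO_12k_add (k : ℕ) : (12 * k).choose 2 + 6 * k = 72 * k ^ 2 := by
  rw [dimSO_12k]
  rcases Nat.eq_zero_or_pos k with rfl | hk
  · simp
  · obtain ⟨j, rfl⟩ : ∃ j, k = j + 1 := ⟨k - 1, by omega⟩
    have h : 12 * (j + 1) - 1 = 12 * j + 11 := by omega
    rw [h]; ring

/-- «`72k² − 6k`» literally, with truncated subtraction (harmless: `6k ≤ 72k²`).
[cite: Markman2025SecantWeil, proof of Prop. 6.1.2 Step 2, p. 32 L50] -/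
theorem dimSO_12k_printed (k : ℕ) : (12 * k).choose 2 = 72 * k ^ 2 - 6 * k :=
  Nat.eq_sub_of_add_eq (dimSO_12k_add k)

/-- [Ob, Theorem B]'s threshold «`(12k − 1)(12k − 2)/2`» `= C(12k − 1, 2)`, in closed form `72k² − 18k + 1` for `k ≥ 1`
(subtraction-free: `threshold + 18k = 72k² + 1`).
[cite: Markman2025SecantWeil, proof of Prop. 6.1.2 Step 2, p. 32 L50–52] -/
theorem threshold_12k (k : ℕ) (hk : 1 ≤ k) : (12 * k - 1) * (12 * k - 2) / 2 + 18 * k = 72 * k ^ 2 + 1 := by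
  obtain ⟨j, rfl⟩ : ∃ j, k = j + 1 := ⟨k - 1, by omega⟩
  have h1 : 12 * (j + 1) - 1 = 12 * j + 11 := by omega
  have h2 : 12 * (j + 1) - 2 = 2 * (6 * j + 5) := by omega
  rw [h1, h2, ← mul_assoc, mul_comm (12 * j + 11) 2, mul_assoc, Nat.mul_div_cancel_left _ (by norm_num)]
  ring

/-- «`dim(G_i) = 2k[20k − 3]`»: `G_i = SO₊(V_i) × SO₊(V_j ⊕ V_l)` with `rank V_i = 4k`, `rank(V_j ⊕ V_l) = 8k`, so
`dim G_i = C(4k, 2) + C(8k, 2) = 2k(4k − 1) + 4k(8k − 1) = 2k(20k − 3)`.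
[cite: Markman2025SecantWeil, proof of Prop. 6.1.2 Step 2, p. 32 L37–45 and p. 33 L12] -/
theorem dimG (k : ℕ) : (4 * k).choose 2 + (8 * k).choose 2 = 2 * k * (20 * k - 3) := by
  have h4 : (4 * k).choose 2 = 2 * k * (4 * k - 1) := by
    rw [Nat.choose_two_right]; exact Nat.div_eq_of_eq_mul_left (by norm_num) (by ring)
  have h8 : (8 * k).choose 2 = 4 * k * (8 * k - 1) := by
    rw [Nat.choose_two_right]; exact Nat.div_eq_of_eq_mul_left (by norm_num) (by ring)
  rw [h4, h8]
  rcases Nat.eq_zero_or_pos k with rfl | hk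
  · simp
  · obtain ⟨j, rfl⟩ : ∃ j, k = j + 1 := ⟨k - 1, by omega⟩
    have e1 : 4 * (j + 1) - 1 = 4 * j + 3 := by omega
    have e2 : 8 * (j + 1) - 1 = 8 * j + 7 := by omega
    have e3 : 20 * (j + 1) - 3 = 20 * j + 17 := by omega
    rw [e1, e2, e3]; ring

/-- «the fiber of `f : G₁ × G₂ × G₃ → SO₊(V_ℚ)` over `1` has dimension `2[3 dim SO₊(V_{i,ℚ}) + 1] = 12k(4k − 1) + 2`»
— the printed formula EVALUATED (`dim SO₊(V_{i,ℚ}) = C(4k, 2) = 2k(4k − 1)`); why the fibre has this dimension is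
[M]'s (p. 33 L3–11) and is not modelled. [cite: Markman2025SecantWeil, proof of Prop. 6.1.2 Step 2, p. 33 L11–12] -/
theorem fiber_dim (k : ℕ) : 2 * (3 * (4 * k).choose 2 + 1) = 12 * k * (4 * k - 1) + 2 := by
  have h4 : (4 * k).choose 2 = 2 * k * (4 * k - 1) := by
    rw [Nat.choose_two_right]; exact Nat.div_eq_of_eq_mul_left (by norm_num) (by ring)
  rw [h4]; ring

/-- «Hence, the dimension of the image of `f` is `6k[20k − 3] − [12k(4k − 1) + 2] = 72k² − 6k − 2`» (`k ≥ 1`;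
`dim(G₁ × G₂ × G₃) = 3 · 2k[20k − 3] = 6k[20k − 3]`; subtraction-free form: `6k[20k − 3] = [12k(4k − 1) + 2] +
[72k² − 6k − 2]`, the last bracket written `72k² − 6k − 2 = (72k² + … )` via `dimSO`).
[cite: Markman2025SecantWeil, proof of Prop. 6.1.2 Step 2, p. 33 L12–14] -/
theorem image_dim (k : ℕ) (hk : 1 ≤ k) :
    6 * k * (20 * k - 3) - (12 * k * (4 * k - 1) + 2) + 6 * k + 2 = 72 * k ^ 2 := by
  obtain ⟨j, rfl⟩ : ∃ j, k = j + 1 := ⟨k - 1, by omega⟩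
  have e1 : 20 * (j + 1) - 3 = 20 * j + 17 := by omega
  have e2 : 4 * (j + 1) - 1 = 4 * j + 3 := by omega
  rw [e1, e2]
  have e3 : 6 * (j + 1) * (20 * j + 17) - (12 * (j + 1) * (4 * j + 3) + 2) = 72 * j ^ 2 + 138 * j + 64 := by
    have : 6 * (j + 1) * (20 * j + 17) = (12 * (j + 1) * (4 * j + 3) + 2) + (72 * j ^ 2 + 138 * j + 64) := by ring
    omega
  rw [e3]; ring

/-- «`= dim SO₊(V_ℚ) − 2`»: the image dimension `6k[20k − 3] − [12k(4k − 1) + 2]` equals `C(12k, 2) − 2` (`k ≥ 1`).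
[cite: Markman2025SecantWeil, proof of Prop. 6.1.2 Step 2, p. 33 L14] -/
theorem image_dim_eq_dimSO_sub_two (k : ℕ) (hk : 1 ≤ k) :
    6 * k * (20 * k - 3) - (12 * k * (4 * k - 1) + 2) = (12 * k).choose 2 - 2 := by
  have h1 := image_dim k hk
  have h2 := dimSO_12k_add k
  have h3 : 2 ≤ (12 * k).choose 2 := by
    rw [dimSO_12k]
    obtain ⟨j, rfl⟩ : ∃ j, k = j + 1 := ⟨k - 1, by omega⟩
    have : 12 * (j + 1) - 1 = 12 * j + 11 := by omega
    rw [this]; nlinarith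
  omega

/-- The tacit comparison behind «Hence, it suffices to prove that the dimension of the Zariski closure of the image of
`f` is `dim(SO₊(V_ℚ)) − 2`»: `dim SO₊(V_ℚ) − 2 = 72k² − 6k − 2` EXCEEDS [Ob]'s threshold
`(12k − 1)(12k − 2)/2 = 72k² − 18k + 1` exactly when `12k > 3`, in particular for every `k ≥ 1`.
[cite: Markman2025SecantWeil, proof of Prop. 6.1.2 Step 2, p. 32 L50–53] -/
theorem image_dim_gt_threshold (k : ℕ) (hk : 1 ≤ k) :
    (12 * k - 1) * (12 * k - 2) / 2 < (12 * k).choose 2 - 2 := by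
  have h1 := threshold_12k k hk
  have h2 := dimSO_12k_add k
  have hk2 : k ≤ k ^ 2 := by nlinarith
  omega

/-- PRINT-READING PRECISION P-6.1.2 (seat lit-w-markman g22, ×1 — NOT an erratum claim; flagged for a second reader).
Counting the fibre `f⁻¹(1)` as printed on p. 33 L3–11 («triples `(g₁, g₂, g₃)`, such that each `g_i` maps each `V_j`
to itself», `g₃ = (g₁g₂)⁻¹`) by pairs of block-diagonal elements gives `2 · 3 dim SO₊(V_{i,ℚ}) = 12k(4k − 1)` with NO
«`+ 1`» inside the bracket; under that count the image of `f` has the FULL dimension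
`6k[20k − 3] − 12k(4k − 1) = 72k² − 6k = dim SO₊(V_ℚ)`. Since Step 2 only needs the image dimension to exceed [Ob]'s
threshold (`image_dim_gt_threshold`), its conclusion is the same under either count. This theorem records the
alternative arithmetic only. [cite: Markman2025SecantWeil, proof of Prop. 6.1.2 Step 2, p. 33 L3–14] -/
theorem image_dim_blockCount (k : ℕ) (hk : 1 ≤ k) :
    6 * k * (20 * k - 3) - 12 * k * (4 * k - 1) = (12 * k).choose 2 := by
  rw [dimSO_12k]
  obtain ⟨j, rfl⟩ : ∃ j, k = j + 1 := ⟨k - 1, by omega⟩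
  have e1 : 20 * (j + 1) - 3 = 20 * j + 17 := by omega
  have e2 : 4 * (j + 1) - 1 = 4 * j + 3 := by omega
  have e3 : 12 * (j + 1) - 1 = 12 * j + 11 := by omega
  rw [e1, e2, e3]
  have : 6 * (j + 1) * (20 * j + 17) = 12 * (j + 1) * (4 * j + 3) + 6 * (j + 1) * (12 * j + 11) := by ring
  omega

/-! ### §B — Step 3: `n = 4`, `V_{E⁴} = V₁ ⊕ V₂ ⊕ V₃`, ranks `4, 4, 8` (total `16`) -/

/-- «Then `dim(G₁ × G₂ × G₃) = 200`»: `G₁ = SO₊(V₁) × SO₊(V₂ ⊕ V₃)` and `G₂` have dimension `C(4,2) + C(12,2) = 6 + 66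
= 72` each, `G₃ = SO₊(V₃) × SO₊(V₁ ⊕ V₂)` has `C(8,2) + C(8,2) = 56`; `72 + 72 + 56 = 200`.
[cite: Markman2025SecantWeil, proof of Prop. 6.1.2 Step 3, p. 33 L15–17] -/
theorem dimG_step3 :
    (Nat.choose 4 2 + Nat.choose 12 2) + (Nat.choose 4 2 + Nat.choose 12 2) + (Nat.choose 8 2 + Nat.choose 8 2)
      = 200 := by
  decide

/-- «`dim SO₊(V_ℚ) = 120`» (`rank V_{E⁴} = 16`, `C(16, 2) = 120`).
[cite: Markman2025SecantWeil, proof of Prop. 6.1.2 Step 3, p. 33 L17] -/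
theorem dimSO_16 : Nat.choose 16 2 = 120 := by decide

/-- «Hence, the dimension of the fiber `f⁻¹(1)` is `82`» — the Step-2 formula `2[Σ_i dim SO₊(V_i) + 1]` at ranks
`4, 4, 8`: `2[(6 + 6 + 28) + 1] = 82`. [cite: Markman2025SecantWeil, proof of Prop. 6.1.2 Step 3, p. 33 L17–19] -/
theorem fiber_dim_step3 : 2 * ((Nat.choose 4 2 + Nat.choose 4 2 + Nat.choose 8 2) + 1) = 82 := by decide

/-- «Again we get that the closure of the image of `f` has codimension `2`»: `200 − 82 = 118 = 120 − 2`.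
[cite: Markman2025SecantWeil, proof of Prop. 6.1.2 Step 3, p. 33 L19–20] -/
theorem image_codim_step3 : 200 - 82 = Nat.choose 16 2 - 2 := by decide

/-- … and codimension `2` again beats [Ob, Theorem B]'s threshold at rank `16`: `(15 · 14)/2 = 105 < 118`.
[cite: Markman2025SecantWeil, proof of Prop. 6.1.2 Steps 2–3, p. 32 L50–52 and p. 33 L19–21] -/
theorem threshold_16 : (16 - 1) * (16 - 2) / 2 < Nat.choose 16 2 - 2 := by decide

/-- P-6.1.2 at `n = 4` (seat remark ×1, as in `image_dim_blockCount`): without the «`+ 1`» the fibre count is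
`2[6 + 6 + 28] = 80` and the image of `f` has the full dimension `200 − 80 = 120 = dim SO₊(V_ℚ)`; the printed
conclusion (Zariski closure `= SO₊(V_ℚ)`) is unaffected.
[cite: Markman2025SecantWeil, proof of Prop. 6.1.2 Step 3, p. 33 L15–21] -/
theorem image_dim_blockCount_step3 :
    2 * (Nat.choose 4 2 + Nat.choose 4 2 + Nat.choose 8 2) = 80 ∧ 200 - 80 = Nat.choose 16 2 := by decide

/-! ### §C — Steps 1 and 4: the induction on `n = dim X` -/

/-- Step 4, `n` even: «If `n` is even, then the statement holds for `E^{3n/2}`, by Step 2 [with `k = n/2`: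
`2k = n`, `3k = 3n/2`] … and so for `n + 1`, by Step 1, since `n + 1 < 3n/2`» — the arithmetic (`n ≥ 4`).
[cite: Markman2025SecantWeil, proof of Prop. 6.1.2 Step 4, p. 33 L24–26] -/
theorem step4_even {n : ℕ} (hn : 4 ≤ n) (he : Even n) :
    2 * (n / 2) = n ∧ 3 * (n / 2) = 3 * n / 2 ∧ n + 1 < 3 * n / 2 := by
  obtain ⟨m, rfl⟩ := he
  omega

/-- Step 4, `n` odd: «If `n` is odd, then `n ≥ 5` [as `n ≥ 4`], the statement holds for `E^{3(n−1)/2}` by Step 2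
[with `k = (n − 1)/2`: `2k = n − 1 ≤ n`] … and so for `n + 1`, by Step 1, since `n + 1 ≤ 3(n − 1)/2`».
[cite: Markman2025SecantWeil, proof of Prop. 6.1.2 Step 4, p. 33 L26–28] -/
theorem step4_odd {n : ℕ} (hn : 4 ≤ n) (ho : Odd n) :
    5 ≤ n ∧ 2 * ((n - 1) / 2) = n - 1 ∧ 3 * ((n - 1) / 2) = 3 * (n - 1) / 2 ∧ n + 1 ≤ 3 * (n - 1) / 2 := by
  obtain ⟨m, rfl⟩ := ho
  omega

/-- THE INDUCTION OF STEP 4 CLOSES. `P n` = «(6.1.10) holds for abelian varieties of dimension `n`» (equivalently for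
`Eⁿ`, Step 1). Inputs, all BY VALUE: `h2` = «The case `n = 2` is assumed» (Lemma 6.2.5); `hdown` = Step 1 («The
statement for abelian varieties of dimension `n` thus implies the statement for abelian varieties of lower
dimension»); `hstep2` = Step 2 («if the statement holds for abelian varieties of dimension `2k`, `k ≥ 1`, then it holds
for abelian varieties of dimension `3k`»); `hstep3` = Step 3 («the case `n = 4`», whose groups
`G₁ = G₂ = SO₊(V_{E¹}) × SO₊(V_{E³})`, `G₃ = SO₊(V_{E²}) × SO₊(V_{E²})` use the cases `n ≤ 3`). Conclusion: `P n` for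
all `n ≥ 1`, by the printed route — `n = 1` from `n = 2` by Step 1; `n = 3` from Step 2 (`k = 1`); `n = 4` from Step 3;
`n + 1` for `n ≥ 4` through `E^{3n/2}` (`n` even) or `E^{3(n−1)/2}` (`n` odd) and Step 1.
[cite: Markman2025SecantWeil, proof of Prop. 6.1.2 Steps 1–4, p. 32 L22–35 and p. 33 L22–28] -/
theorem all_of_steps (P : ℕ → Prop) (h2 : P 2) (hdown : ∀ m n, P n → m ≤ n → P m)
    (hstep2 : ∀ k, 1 ≤ k → P (2 * k) → P (3 * k)) (hstep3 : (∀ m, m ≤ 3 → 1 ≤ m → P m) → P 4) :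
    ∀ n, 1 ≤ n → P n := by
  -- «The case n = 2 is assumed and implies the case n = 1, by Step 1. The case n = 3 follows from Step 2»
  have h1 : P 1 := hdown 1 2 h2 (by norm_num)
  have h3 : P 3 := hstep2 1 le_rfl h2
  have hle3 : ∀ m, m ≤ 3 → 1 ≤ m → P m := by
    intro m hm hm1
    interval_cases m <;> assumption
  -- «and the case n = 4 from Step 3»
  have h4 : P 4 := hstep3 hle3
  -- «Assume that n ≥ 4 and the statement holds for E^k, for k ≤ n. We prove it for E^{n+1}.»
  intro n hn
  induction n using Nat.strong_induction_on with
  | _ n ih =>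
    rcases Nat.lt_or_ge n 5 with hlt | hge
    · interval_cases n <;> assumption
    · -- `n = n' + 1` with `n' ≥ 4`
      obtain ⟨n', rfl⟩ : ∃ n', n = n' + 1 := ⟨n - 1, by omega⟩
      have hn' : 4 ≤ n' := by omega
      have hPn' : P n' := ih n' (by omega) (by omega)
      rcases Nat.even_or_odd n' with he | ho
      · -- «If n is even, then the statement holds for E^{3n/2}, by Step 2 … and so for n + 1 … since n + 1 < 3n/2»
        obtain ⟨hk2, _, hlt⟩ := step4_even hn' he
        have hP3 : P (3 * (n' / 2)) := hstep2 (n' / 2) (by omega) (by rw [hk2]; exact hPn')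
        exact hdown (n' + 1) (3 * (n' / 2)) hP3 (by omega)
      · -- «If n is odd, then n ≥ 5, the statement holds for E^{3(n−1)/2} … and so for n + 1 … since n + 1 ≤ 3(n−1)/2»
        obtain ⟨_, hk2, _, hle⟩ := step4_odd hn' ho
        have hPm : P (n' - 1) := ih (n' - 1) (by omega) (by omega)
        have hP3 : P (3 * ((n' - 1) / 2)) := hstep2 ((n' - 1) / 2) (by omega) (by rw [hk2]; exact hPm)
        exact hdown (n' + 1) (3 * ((n' - 1) / 2)) hP3 (by omega)

/-! ### §D — «the class `½[c₁(𝒫) − ρ_g(c₁(𝒫))]` is indeed integral» (value level) -/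

/-- «Notice that the integral alternating bilinear form `c₁(𝒫)` and the symmetric bilinear pairing `(•, •)_V` agree
modulo 2, and so the class `½[c₁(𝒫) − ρ_g(c₁(𝒫))]` is indeed integral, for every element `g ∈ Spin(V)`» — at the level
of values: if `c(x, y) ≡ B(x, y) (mod 2)` for all `x, y` and `ρ` (here `ρ_g⁻¹`, an isometry of `(•, •)_V`) preserves
`B`, then `c(x, y) − c(ρx, ρy)` is even for all `x, y` (`ρ_g(c₁(𝒫))(x, y) = c₁(𝒫)(ρ_g⁻¹x, ρ_g⁻¹y)`).
[cite: Markman2025SecantWeil, Prop. 6.1.2, p. 32 L16–19] -/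
theorem even_sub_of_agree_mod_two {V : Type*} (c B : V → V → ℤ) (ρ : V → V)
    (hagree : ∀ x y, Even (c x y - B x y)) (hρ : ∀ x y, B (ρ x) (ρ y) = B x y) (x y : V) :
    Even (c x y - c (ρ x) (ρ y)) := by
  have h1 := hagree x y
  have h2 := hagree (ρ x) (ρ y)
  rw [hρ] at h2
  have : c x y - c (ρ x) (ρ y) = (c x y - B x y) - (c (ρ x) (ρ y) - B x y) := by ring
  rw [this]
  exact h1.sub h2

end Literature.AlgebraicGeometry.Markman2025.Prop612
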